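import Mathlib

/-!
# Template lattices are split — Aux file 1: square-valued forms
# (crux `HcpDiffractionRigidity`, item `stmt-AtomisticToContinuum-13166`,
# stub `stub_templateLatticeSplit`, B2c₁ᵦ)

Toward the splitting of a full-rank lattice of hcp-template-length vectors (`h²/a² ∉ ℚ`): the
`h²`-part `H` of the Gram pencil `⟨z, z'⟩ = a² A(z,z') + h² H(z,z')` takes perfect-square values
`H(z,z) = m²` (the squared layer difference), and

* `HcpRigiditySplit.discrim_eq_zero_of_forall_sq` — a rational quadratic polynomial whose values at
  all naturals are squares of integers has zero discriminant (growth argument);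
* `HcpRigiditySplit.exists_eq_mul_of_forall_sq` — hence a symmetric biadditive `ℚ`-valued form
  with perfect-square diagonal is `ℓ ⊗ ℓ` for an additive `ℓ : M →+ ℤ` ("the layer index").

Registered helper stub: `stub_templateLatticeSplit_sqForm` (the second fact for submodules of
`ℝ³`).  All `[folklore]`.
-/

noncomputable section

namespace Summit.AtomisticToContinuum.Crystallization.Theorems

namespace HcpRigiditySplit

open Filter Metric Set
open scoped BigOperators Topology

/-! ## Square-valued quadratic polynomials -/

/-- An integer sequence converging in `ℝ` is eventually constant, equal to its limit. [folklore] -/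
theorem exists_forall_cast_eq_of_tendsto {u : ℕ → ℤ} {l : ℝ}
    (h : Tendsto (fun n => (u n : ℝ)) atTop (𝓝 l)) : ∃ N : ℕ, ∀ n ≥ N, (u n : ℝ) = l := by
  obtain ⟨N, hN⟩ := Metric.tendsto_atTop.1 h (1 / 2) (by norm_num)
  have hconst : ∀ n ≥ N, u n = u N := by
    intro n hn
    have h1 := hN n hn
    have h2 := hN N le_rfl
    rw [Real.dist_eq] at h1 h2
    have h3 : |((u n - u N : ℤ) : ℝ)| < 1 := by
      push_cast
      calc |(u n : ℝ) - u N| = |((u n : ℝ) - l) - ((u N : ℝ) - l)| := by ring_nf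
        _ ≤ |(u n : ℝ) - l| + |(u N : ℝ) - l| := abs_sub _ _
        _ < 1 := by linarith
    have h4 : u n - u N = 0 := by rw [← Int.abs_lt_one_iff]; exact_mod_cast h3
    linarith
  have hlim : Tendsto (fun n => (u n : ℝ)) atTop (𝓝 (u N : ℝ)) :=
    tendsto_const_nhds.congr' (by
      filter_upwards [eventually_ge_atTop N] with n hn
      rw [hconst n hn])
  have hl : (u N : ℝ) = l := tendsto_nhds_unique hlim h
  exact ⟨N, fun n hn => by rw [hconst n hn, hl]⟩

/-- **A quadratic polynomial over `ℚ` whose values at all naturals are squares of integers has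
vanishing discriminant** (growth argument: the leading coefficient is a square `D²`, the first
differences of the roots converge to `D` hence are eventually equal to `D`, and then the
polynomial is `(D n + E)²`). [folklore] -/
theorem discrim_eq_zero_of_forall_sq (α β γ : ℚ)
    (h : ∀ n : ℕ, ∃ m : ℤ, α * (n : ℚ) ^ 2 + β * n + γ = (m : ℚ) ^ 2) : β ^ 2 = 4 * α * γ := by
  choose m' hm' using h
  set m : ℕ → ℕ := fun n => (m' n).natAbs with hmdef
  have hm : ∀ n : ℕ, α * (n : ℚ) ^ 2 + β * n + γ = ((m n : ℕ) : ℚ) ^ 2 := fun n => by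
    rw [hm' n, hmdef]
    simp only [Nat.cast_natAbs, Int.cast_abs, sq_abs]
  have hnonneg : ∀ n : ℕ, 0 ≤ α * (n : ℚ) ^ 2 + β * n + γ := fun n => by rw [hm n]; positivity
  -- eventually negative polynomials are excluded
  have hneg : ∀ b c : ℚ, (∀ n : ℕ, 0 ≤ b * n + c) → 0 ≤ b := by
    intro b c hbc
    by_contra hb
    rw [not_le] at hb
    obtain ⟨n, hn⟩ := exists_nat_gt ((|c| + 1) / -b)
    have h1 : (|c| + 1) < -b * n := by rw [div_lt_iff₀ (by linarith)] at hn; linarith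
    have h2 := hbc n
    have h3 := le_abs_self c
    nlinarith
  rcases lt_trichotomy α 0 with hα | hα | hα
  · -- `α < 0`
    exfalso
    obtain ⟨n, hn⟩ := exists_nat_gt ((|β| + |γ| + 1) / -α)
    have h1 : (|β| + |γ| + 1) < -α * n := by rw [div_lt_iff₀ (by linarith)] at hn; linarith
    have hn1 : (1 : ℚ) ≤ n := by
      by_contra h0
      rw [not_le] at h0
      have : (n : ℚ) = 0 := by exact_mod_cast Nat.lt_one_iff.1 (by exact_mod_cast h0)
      rw [this] at h1
      linarith [abs_nonneg β, abs_nonneg γ]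
    have h2 := hnonneg n
    have h3 : β * n ≤ |β| * n := mul_le_mul_of_nonneg_right (le_abs_self β) (by linarith)
    have h4 : γ ≤ |γ| * n := (le_abs_self γ).trans (le_mul_of_one_le_right (abs_nonneg γ) hn1)
    nlinarith
  · -- `α = 0`: a linear polynomial with square values is constant
    subst hα
    suffices hβ : β = 0 by rw [hβ]; ring
    have hβ0 : 0 ≤ β := hneg β γ fun n => by simpa using hnonneg n
    rcases hβ0.lt_or_eq with hβ | hβ
    · exfalso
      have hdiff : ∀ n : ℕ, ((m (n + 1) : ℕ) : ℚ) ^ 2 - ((m n : ℕ) : ℚ) ^ 2 = β := fun n => by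
        rw [← hm, ← hm]; push_cast; ring
      have hbound : ∀ n : ℕ, ((m n : ℕ) : ℚ) ≤ β := by
        intro n
        have h1 := hdiff n
        have hne : m (n + 1) ≠ m n := by
          intro heq; rw [heq, sub_self] at h1; exact hβ.ne' h1.symm
        have h2 : (1 : ℚ) ≤ |((m (n + 1) : ℕ) : ℚ) - m n| := by
          have hc : ((m (n + 1) : ℕ) : ℚ) - m n = ((((m (n + 1) : ℕ) : ℤ) - (m n : ℕ) : ℤ) : ℚ) := by
            push_cast; ring
          have hz : (((m (n + 1) : ℕ) : ℤ) - (m n : ℕ) : ℤ) ≠ 0 := by omega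
          rw [hc, ← Int.cast_abs]
          exact_mod_cast Int.one_le_abs hz
        have h3 : β = (((m (n + 1) : ℕ) : ℚ) - m n) * (((m (n + 1) : ℕ) : ℚ) + m n) := by
          rw [← h1]; ring
        have h5 : ((m (n + 1) : ℕ) : ℚ) + m n ≤ |β| := by
          rw [h3, abs_mul, abs_of_nonneg (by positivity : (0 : ℚ) ≤ ((m (n + 1) : ℕ) : ℚ) + m n)]
          exact le_mul_of_one_le_left (by positivity) h2
        rw [abs_of_pos hβ] at h5
        have h6 : (0 : ℚ) ≤ ((m (n + 1) : ℕ) : ℚ) := by positivity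
        linarith
      obtain ⟨n, hn⟩ := exists_nat_gt ((β ^ 2 - γ) / β)
      have h1 : β ^ 2 - γ < β * n := by rwa [div_lt_iff₀ hβ, mul_comm] at hn
      have h2 := hm n
      have h3 := hbound n
      have h4 : ((m n : ℕ) : ℚ) ^ 2 ≤ β ^ 2 := pow_le_pow_left₀ (by positivity) h3 2
      nlinarith
    · exact hβ.symm
  · -- `α > 0`: growth argument in `ℝ`
    have hmR : ∀ n : ℕ, (α : ℝ) * (n : ℝ) ^ 2 + β * n + γ = ((m n : ℕ) : ℝ) ^ 2 := fun n => by
      exact_mod_cast congrArg (fun x : ℚ => (x : ℝ)) (hm n)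
    set s : ℝ := √α with hs
    have hs0 : 0 < s := Real.sqrt_pos.2 (by exact_mod_cast hα)
    have hss : s ^ 2 = α := Real.sq_sqrt (by exact_mod_cast hα.le)
    -- `m n / n → s`
    have hinv : Tendsto (fun n : ℕ => (n : ℝ)⁻¹) atTop (𝓝 0) := tendsto_inv_atTop_nhds_zero_nat
    have hq : Tendsto (fun n : ℕ => (((m n : ℕ) : ℝ) / n) ^ 2) atTop (𝓝 (α : ℝ)) := by
      have h1 : Tendsto (fun n : ℕ => (α : ℝ) + β * (n : ℝ)⁻¹ + γ * ((n : ℝ)⁻¹) ^ 2) atTop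
          (𝓝 ((α : ℝ) + β * 0 + γ * 0 ^ 2)) :=
        (tendsto_const_nhds.add (tendsto_const_nhds.mul hinv)).add
          (tendsto_const_nhds.mul (hinv.pow 2))
      rw [mul_zero, zero_pow two_ne_zero, mul_zero, add_zero, add_zero] at h1
      refine h1.congr' ?_
      filter_upwards [eventually_ge_atTop 1] with n hn
      have hn0 : (n : ℝ) ≠ 0 := by positivity
      rw [div_pow, ← hmR n]
      field_simp
    have hratio : Tendsto (fun n : ℕ => ((m n : ℕ) : ℝ) / n) atTop (𝓝 s) := by
      have h1 := ((Real.continuous_sqrt.tendsto _).comp hq)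
      refine h1.congr' ?_
      filter_upwards [eventually_ge_atTop 1] with n hn
      simp only [Function.comp]
      exact Real.sqrt_sq (by positivity)
    -- `x n = m n - s n → β / (2 s)`
    have hx : Tendsto (fun n : ℕ => ((m n : ℕ) : ℝ) - s * n) atTop (𝓝 ((β : ℝ) / (2 * s))) := by
      have h1 : Tendsto (fun n : ℕ => ((β : ℝ) + γ * (n : ℝ)⁻¹) / (((m n : ℕ) : ℝ) / n + s)) atTop
          (𝓝 (((β : ℝ) + γ * 0) / (s + s))) :=
        (tendsto_const_nhds.add (tendsto_const_nhds.mul hinv)).div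
          (hratio.add tendsto_const_nhds) (by positivity)
      rw [mul_zero, add_zero, ← two_mul] at h1
      refine h1.congr' ?_
      filter_upwards [eventually_ge_atTop 1] with n hn
      have hn0 : (0 : ℝ) < n := by exact_mod_cast hn
      have hden : 0 < ((m n : ℕ) : ℝ) / n + s := by positivity
      have hden' : 0 < ((m n : ℕ) : ℝ) + s * n := by positivity
      have hkey : (((m n : ℕ) : ℝ) - s * n) * (((m n : ℕ) : ℝ) + s * n) = β * n + γ := by
        have := hmR n
        rw [← hss] at this
        linear_combination -this
      have hprod : (((m n : ℕ) : ℝ) - s * n) * (((m n : ℕ) : ℝ) / n + s) = β + γ * (n : ℝ)⁻¹ := by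
        have e1 : ((m n : ℕ) : ℝ) / n + s = (((m n : ℕ) : ℝ) + s * n) / n := by
          field_simp
        rw [e1, mul_div_assoc', hkey]
        field_simp
      rw [← hprod, mul_div_cancel_right₀ _ hden.ne']
    -- first differences: `m (n+1) - m n → s`, hence eventually `= s =: D`
    set d : ℕ → ℤ := fun n => ((m (n + 1) : ℕ) : ℤ) - ((m n : ℕ) : ℤ) with hddef
    have hd : Tendsto (fun n : ℕ => (d n : ℝ)) atTop (𝓝 s) := by
      have h1 := ((hx.comp (tendsto_add_atTop_nat 1)).sub hx).add_const s
      rw [sub_self, zero_add] at h1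
      refine h1.congr' (Eventually.of_forall fun n => ?_)
      simp only [Function.comp, hddef]
      push_cast
      ring
    obtain ⟨N, hN⟩ := exists_forall_cast_eq_of_tendsto hd
    set D : ℤ := d N with hD
    have hDs : (D : ℝ) = s := hN N le_rfl
    -- `e n = m n - D n → β / (2 s)`, hence eventually `= β / (2 s) =: E`
    set e : ℕ → ℤ := fun n => ((m n : ℕ) : ℤ) - D * n with hedef
    have he : Tendsto (fun n : ℕ => (e n : ℝ)) atTop (𝓝 ((β : ℝ) / (2 * s))) := by
      refine hx.congr' (Eventually.of_forall fun n => ?_)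
      simp only [hedef]
      push_cast
      rw [hDs]
    obtain ⟨N', hN'⟩ := exists_forall_cast_eq_of_tendsto he
    set E : ℤ := e N' with hE
    have hEs : (E : ℝ) = β / (2 * s) := hN' N' le_rfl
    have hβ : (β : ℝ) = 2 * D * E := by
      rw [hEs, hDs]; field_simp
    have hmN : ((m N' : ℕ) : ℝ) = D * N' + E := by
      have : ((E : ℤ) : ℝ) = ((m N' : ℕ) : ℝ) - D * N' := by rw [hE, hedef]; push_cast; ring
      linarith
    have hαD : (α : ℝ) = (D : ℝ) ^ 2 := by rw [hDs, hss]
    have hγ : (γ : ℝ) = (E : ℝ) ^ 2 := by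
      have := hmR N'
      rw [hmN, hαD, hβ] at this
      linear_combination this
    have : ((β ^ 2 : ℚ) : ℝ) = ((4 * α * γ : ℚ) : ℝ) := by
      push_cast
      rw [hβ, hαD, hγ]; ring
    exact_mod_cast this

/-- **A square-valued symmetric bilinear form is the square of an additive integer functional.**
If `H` is a symmetric biadditive `ℚ`-valued form on an abelian group all of whose diagonal values
`H(x, x)` are squares of integers, then `H(x, y) = ℓ(x) ℓ(y)` for an additive `ℓ : M → ℤ`
(Cauchy–Schwarz is an equality everywhere by `discrim_eq_zero_of_forall_sq` applied to
`n ↦ H(y + n x, y + n x)`, so `H` has rank `≤ 1`). [folklore] -/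
theorem exists_eq_mul_of_forall_sq {M : Type*} [AddCommGroup M] (H : M →+ M →+ ℚ)
    (hsymm : ∀ x y, H x y = H y x) (hsq : ∀ x, ∃ m : ℤ, H x x = (m : ℚ) ^ 2) :
    ∃ ℓ : M →+ ℤ, ∀ x y, H x y = (ℓ x : ℚ) * ℓ y := by
  -- Cauchy–Schwarz with equality
  have hcs : ∀ x y, H x y ^ 2 = H x x * H y y := by
    intro x y
    have key := discrim_eq_zero_of_forall_sq (H x x) (2 * H x y) (H y y) fun n => by
      obtain ⟨m, hm⟩ := hsq (y + (n : ℤ) • x)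
      refine ⟨m, ?_⟩
      rw [← hm]
      simp only [map_add, map_zsmul, AddMonoidHom.add_apply, AddMonoidHom.zsmul_apply,
        zsmul_eq_mul, hsymm x y]
      push_cast
      ring
    linear_combination key / 4
  by_cases h0 : ∀ x, H x x = 0
  · refine ⟨0, fun x y => ?_⟩
    have h1 := hcs x y
    rw [h0 x, zero_mul] at h1
    simpa using h1
  push Not at h0
  obtain ⟨z₀, hz₀⟩ := h0
  obtain ⟨m₀, hm₀⟩ := hsq z₀
  have hm0 : (m₀ : ℚ) ≠ 0 := by
    intro h; apply hz₀; rw [hm₀, h]; ring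
  -- the rational functional `ℓQ x = H(x, z₀) / m₀`
  set ℓQ : M →+ ℚ :=
    { toFun := fun x => H x z₀ / m₀
      map_zero' := by simp
      map_add' := fun x y => by simp only [map_add, AddMonoidHom.add_apply]; ring } with hℓQ
  have hℓQ_apply : ∀ x, ℓQ x = H x z₀ / m₀ := fun x => rfl
  have hdiag : ∀ x, H x x = ℓQ x ^ 2 := by
    intro x
    have h1 := hcs x z₀
    rw [hm₀] at h1
    rw [hℓQ_apply, div_pow, eq_div_iff (pow_ne_zero 2 hm0)]
    linear_combination -h1
  have hkey : ∀ x y, H x y = ℓQ x * ℓQ y := by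
    intro x y
    have h1 := hdiag (x + y)
    have h2 := hdiag x
    have h3 := hdiag y
    simp only [map_add, AddMonoidHom.add_apply, hsymm y x] at h1
    linear_combination (h1 - h2 - h3) / 2
  -- integrality of `ℓQ`
  have hint : ∀ x, ∃ k : ℤ, ℓQ x = k := by
    intro x
    obtain ⟨m, hm⟩ := hsq x
    rw [hdiag x] at hm
    have h1 : (ℓQ x - m) * (ℓQ x + m) = 0 := by linear_combination hm
    rcases mul_eq_zero.1 h1 with h2 | h2
    · exact ⟨m, by linarith⟩
    · exact ⟨-m, by push_cast; linarith⟩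
  choose k hk using hint
  refine ⟨{ toFun := k, map_zero' := ?_, map_add' := fun x y => ?_ }, fun x y => ?_⟩
  · have h1 := hk 0
    rw [map_zero] at h1
    exact_mod_cast h1.symm
  · have h1 := hk (x + y)
    rw [map_add, hk x, hk y] at h1
    exact_mod_cast h1.symm
  · change H x y = (k x : ℚ) * k y
    rw [hkey, hk, hk]

end HcpRigiditySplit

/-- **Registered helper stub of `stub_templateLatticeSplit` (Aux file 1): a square-valued
symmetric biadditive form is the square of an additive integer functional.** If
`H : N → N → ℚ` is symmetric, biadditive and `H(x,x)` is the square of an integer for every `x`,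
then `H(x,y) = ℓ(x) ℓ(y)` for an additive `ℓ : N →+ ℤ`. [folklore] -/
theorem stub_templateLatticeSplit_sqForm : ∀ (N : Submodule ℤ (EuclideanSpace ℝ (Fin 3))) (H : ↥N →+ ↥N →+ ℚ), (∀ x y : ↥N, H x y = H y x) → (∀ x : ↥N, ∃ m : ℤ, H x x = (m : ℚ) ^ 2) → ∃ ℓ : ↥N →+ ℤ, ∀ x y : ↥N, H x y = (ℓ x : ℚ) * (ℓ y : ℚ) :=
  fun _ H hsymm hsq => HcpRigiditySplit.exists_eq_mul_of_forall_sq H hsymm hsq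

end Summit.AtomisticToContinuum.Crystallization.Theorems
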